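import Mathlib
import HarnessLib
import Summits.HubbardSuperconductivity.HubbardSuperconductivity.Theorems.KLProgrammeKLRegimeEnginePairTransferOutClassForward

/-!
# Route `KLProgramme` — ENGINE item stmt-HubbardSuperconductivity-20437 `KLRegimeEngineV17F2`, stub (c) value lane, «(c)-OUT»: THE THERMAL BAND — at the last three scales
# `n_β − 2 ≤ n ≤ n_β` the bar itself swallows the sign-blind member masses (cell gate-hubbard-kl, seat hubbard-kl-k3c2-p2 g18, technique «thermal-bar induction n ≤ nScales β + 1»)

Where the crossed forward window has no room for its bosonic shift (`16π/β ≤ Λₙ₊₁` fails, i.e. `n_β ≤ n + 2`), `thermalBar klEngGeo11 P U β (n+1) = CF·(Klam U)²·4^{−(n_β−(n+1))}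
≥ CF·(Klam U)²/4 ≥ 2⁷⁸(Klam U)²` (`two_pow_eighty_le_klEngGeo11_CF`), and the flat member masses `M4²·2²⁵ ≤ 2²⁸(Klam U)²` fit a QUARTER of it:
`thermalBar_klEngGeo11_ge_of_band`, `flat_mul_le_thermalBar_quarter_of_band`, **`Wd/Wx_member_row_flat_le_thermalBar_of_band`** (every leg transfer).
Arithmetic over landed rows; nothing about the model is asserted; nothing asserts (E2″-F), (c), K3 or superconductivity.
-/

noncomputable section

namespace Summit.HubbardSuperconductivity.HubbardSuperconductivity.Theorems.KLRegimeSplit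

set_option linter.dupNamespace false -- summit = problem name (single-conjunct summit), D-0017

open Real Set Finset Complex Literature.MathematicalPhysics.QuantumLattice
open Literature.Probability.LatticeModels hiding torusSupNorm
open Literature.MathematicalPhysics.QuantumLattice.BandSectorCounting
open Summit.HubbardSuperconductivity.HubbardSuperconductivity.Theorems.KLProgrammeLegKernels
open Summit.HubbardSuperconductivity.HubbardSuperconductivity.Theorems.KLRegimeWick
open Summit.HubbardSuperconductivity.HubbardSuperconductivity.Theorems.TwoPointAssembly
open Summit.HubbardSuperconductivity.HubbardSuperconductivity.Theorems.EngineV8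
open Summit.HubbardSuperconductivity.HubbardSuperconductivity.Theorems.DispersionFlow
open Summit.HubbardSuperconductivity.HubbardSuperconductivity.Theorems.PerturbedFermiCurve

/-! ## The thermal band -/

section Band

variable {L M : ℕ} [NeZero L] [NeZero M] (β μ : ℝ) (K : TrigPolyC4v) {R : RenConsts} {U : ℝ} {N : ℕ}

omit [NeZero L] [NeZero M] in
/-- **In the thermal band the bar is flat and huge**: `n_β ≤ n + 2 ⇒ 2⁷⁸·(Klam U)² ≤ thermalBar klEngGeo11 P U β (n+1)` (`(4^{n_β−(n+1)})⁻¹ ≥ 1/4`, `CF ≥ 2⁸⁰`). -/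
theorem thermalBar_klEngGeo11_ge_of_band {β : ℝ} {n : ℕ} (hband : nScales β ≤ n + 2) (P : SplitConsts) (U : ℝ) :
    2 ^ 78 * (P.Klam * U) ^ 2 ≤ thermalBar klEngGeo11 P U β (n + 1) := by
  have hKl : 0 ≤ (P.Klam * U) ^ 2 := sq_nonneg _
  have hCF := two_pow_eighty_le_klEngGeo11_CF
  have hexp : nScales β - (n + 1) ≤ 1 := by omega
  have hq : (4 : ℝ)⁻¹ ≤ ((4 : ℝ) ^ (nScales β - (n + 1)))⁻¹ := by
    have h : (4 : ℝ) ^ (nScales β - (n + 1)) ≤ 4 ^ 1 := pow_le_pow_right₀ (by norm_num) hexp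
    rw [pow_one] at h
    exact inv_anti₀ (by positivity) h
  unfold thermalBar
  have h1 : klEngGeo11.CF * (P.Klam * U) ^ 2 * (4 : ℝ)⁻¹ ≤ klEngGeo11.CF * (P.Klam * U) ^ 2 * ((4 : ℝ) ^ (nScales β - (n + 1)))⁻¹ :=
    mul_le_mul_of_nonneg_left hq (mul_nonneg klEngGeo11_CF_nonneg hKl)
  have h2 : 2 ^ 80 * (P.Klam * U) ^ 2 ≤ klEngGeo11.CF * (P.Klam * U) ^ 2 := mul_le_mul_of_nonneg_right hCF hKl
  linarith

/-- Band booking arithmetic: `W ≤ 2048·15367`, `0 ≤ Mq ≤ 2³·Kl²` ⇒ `Mq·W ≤ thermalBar/4` in the band. -/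
theorem flat_mul_le_thermalBar_quarter_of_band {Mq W : ℝ} (hW : W ≤ 2048 * 15367) (hMq : 0 ≤ Mq) {P : SplitConsts} {U β : ℝ}
    (hM : Mq ≤ 2 ^ 3 * (P.Klam * U) ^ 2) {n : ℕ} (hband : nScales β ≤ n + 2) :
    Mq * W ≤ thermalBar klEngGeo11 P U β (n + 1) / 4 := by
  have h := thermalBar_klEngGeo11_ge_of_band hband P U
  have hKl : 0 ≤ (P.Klam * U) ^ 2 := sq_nonneg _
  have h1 : Mq * W ≤ Mq * (2048 * 15367) := mul_le_mul_of_nonneg_left hW hMq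
  have h2 : Mq * (2048 * 15367) ≤ 2 ^ 3 * (P.Klam * U) ^ 2 * (2048 * 15367) := mul_le_mul_of_nonneg_right hM (by norm_num)
  have h3 : (2 : ℝ) ^ 3 * (2048 * 15367) ≤ 2 ^ 76 := by norm_num
  nlinarith only [h, h1, h2, h3, hKl]

/-- **DIRECT member ph mass in the thermal band** (`n_β ≤ n + 2`, every leg transfer; `FrameOK`, `klBetaMin ≤ β ≤ L`; `0 ≤ Mq ≤ 2³(Klam U)²`):
`Mq·(Λₙ−Λₙ₊₁)((βL²)³)⁻¹·Wd_j(t,x,y) ≤ thermalBar klEngGeo11 P U β (n+1)/4`. -/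
theorem Wd_member_row_flat_le_thermalBar_of_band (hK : FrameOK R U N μ K) (hβm : klBetaMin ≤ β) (hβL : β ≤ L) (n : ℕ) {j : ℕ} (hj : n + 1 ≤ j)
    (hband : nScales β ≤ n + 2) {t : ℝ} (ht : t ∈ Icc (0 : ℝ) 1) (x y : TorusSite 2 L) {P : SplitConsts} {Mq : ℝ} (hMq : 0 ≤ Mq)
    (hM : Mq ≤ 2 ^ 3 * (P.Klam * U) ^ 2) :
    Mq * ((klScale klE0 n - klScale klE0 (n + 1)) * ((β * (L : ℝ) ^ 2) ^ 3)⁻¹ *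
      ∑ p : FreqMomentum L M, ∑ _σ : Fin 2, ∑ p' : FreqMomentum L M,
        (if matsubaraInt M p'.1 + matsubaraInt M (omega0 M) = matsubaraInt M p.1 + matsubaraInt M (omega0 M) ∧ p'.2 = p.2 + x - y then
          ‖((((softSymbolCompl L M β μ K (n + 1) j p + (hubbardCutoffWeightCT L M β μ K (klScale klE0 (n + 1)) p -
                hubbardCutoffWeightCT L M β μ K (klScale klE0 n + t * (klScale klE0 (n + 1) - klScale klE0 n)) p) : ℝ)) : ℂ) *
                (((β * (L : ℝ) ^ 2 : ℝ) : ℂ) * propCT L M β μ K p)) *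
              ((((deriv (fun Λ' : ℝ => hubbardCutoffWeightCT L M β μ K Λ' p') (klScale klE0 n + t * (klScale klE0 (n + 1) - klScale klE0 n)) : ℝ)) : ℂ) *
                (((β * (L : ℝ) ^ 2 : ℝ) : ℂ) * propCT L M β μ K p')) +
            ((((deriv (fun Λ' : ℝ => hubbardCutoffWeightCT L M β μ K Λ' p) (klScale klE0 n + t * (klScale klE0 (n + 1) - klScale klE0 n)) : ℝ)) : ℂ) *
                (((β * (L : ℝ) ^ 2 : ℝ) : ℂ) * propCT L M β μ K p)) *
              ((((softSymbolCompl L M β μ K (n + 1) j p' + (hubbardCutoffWeightCT L M β μ K (klScale klE0 (n + 1)) p' -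
                hubbardCutoffWeightCT L M β μ K (klScale klE0 n + t * (klScale klE0 (n + 1) - klScale klE0 n)) p') : ℝ)) : ℂ) *
                (((β * (L : ℝ) ^ 2 : ℝ) : ℂ) * propCT L M β μ K p'))‖
        else 0)) ≤
      thermalBar klEngGeo11 P U β (n + 1) / 4 :=
  flat_mul_le_thermalBar_quarter_of_band (Wd_member_row_flat_le β μ K hK hβm hβL n hj ht x y) hMq hM hband

/-- **CROSSED member ph mass in the thermal band** (as `Wd_member_row_flat_le_thermalBar_of_band`). -/
theorem Wx_member_row_flat_le_thermalBar_of_band (hK : FrameOK R U N μ K) (hβm : klBetaMin ≤ β) (hβL : β ≤ L) (n : ℕ) {j : ℕ} (hj : n + 1 ≤ j)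
    (hband : nScales β ≤ n + 2) {t : ℝ} (ht : t ∈ Icc (0 : ℝ) 1) (Qm x y : TorusSite 2 L) {P : SplitConsts} {Mq : ℝ} (hMq : 0 ≤ Mq)
    (hM : Mq ≤ 2 ^ 3 * (P.Klam * U) ^ 2) :
    Mq * ((klScale klE0 n - klScale klE0 (n + 1)) * ((β * (L : ℝ) ^ 2) ^ 3)⁻¹ *
      ∑ p : FreqMomentum L M, ∑ p' : FreqMomentum L M,
        (if matsubaraInt M p'.1 + matsubaraInt M (omega0 M) + matsubaraInt M (omega0 M) + 1 = matsubaraInt M p.1 ∧ p'.2 = p.2 + Qm - x - y then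
          ‖((((softSymbolCompl L M β μ K (n + 1) j p + (hubbardCutoffWeightCT L M β μ K (klScale klE0 (n + 1)) p -
                hubbardCutoffWeightCT L M β μ K (klScale klE0 n + t * (klScale klE0 (n + 1) - klScale klE0 n)) p) : ℝ)) : ℂ) *
                (((β * (L : ℝ) ^ 2 : ℝ) : ℂ) * propCT L M β μ K p)) *
              ((((deriv (fun Λ' : ℝ => hubbardCutoffWeightCT L M β μ K Λ' p') (klScale klE0 n + t * (klScale klE0 (n + 1) - klScale klE0 n)) : ℝ)) : ℂ) *
                (((β * (L : ℝ) ^ 2 : ℝ) : ℂ) * propCT L M β μ K p')) +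
            ((((deriv (fun Λ' : ℝ => hubbardCutoffWeightCT L M β μ K Λ' p) (klScale klE0 n + t * (klScale klE0 (n + 1) - klScale klE0 n)) : ℝ)) : ℂ) *
                (((β * (L : ℝ) ^ 2 : ℝ) : ℂ) * propCT L M β μ K p)) *
              ((((softSymbolCompl L M β μ K (n + 1) j p' + (hubbardCutoffWeightCT L M β μ K (klScale klE0 (n + 1)) p' -
                hubbardCutoffWeightCT L M β μ K (klScale klE0 n + t * (klScale klE0 (n + 1) - klScale klE0 n)) p') : ℝ)) : ℂ) *
                (((β * (L : ℝ) ^ 2 : ℝ) : ℂ) * propCT L M β μ K p'))‖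
        else 0)) ≤
      thermalBar klEngGeo11 P U β (n + 1) / 4 :=
  flat_mul_le_thermalBar_quarter_of_band ((Wx_member_row_flat_le β μ K hK hβm hβL n hj ht Qm x y).trans (by norm_num)) hMq hM hband

end Band

end Summit.HubbardSuperconductivity.HubbardSuperconductivity.Theorems.KLRegimeSplit

end
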